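import Mathlib.Data.ZMod.Units
import Mathlib.Data.Nat.Totient
import Mathlib.Analysis.Complex.Basic
import HarnessLib

/-!
# Route `PrimeLevelFamEdge`, crux K_B (stmt-Parity-20343), line `diagonal_kernel_split` rev 4, plan Ω,
# sub-line Ω-e/f/g interface (GATE G2 §(a) a8 = a8P + a8R + a8S) — **level sums in an arithmetic progression:
# PRINCIPAL part (density `1/φ(n)` × the coprime sum) + DEVIATION, the exact algebraic split**

After the divisor switch (`OffDiagDivisorSwitch`: for fixed `(h₁, c, s)` the prime levels `q` of the block run over the
arithmetic progression `q ≡ −ab·(cs)⁻¹ (mod |h₁|)`, `dvd_iff_natCast_level_eq`), the dual head of the heart is a sum of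
LEVEL SUMS IN RESIDUE CLASSES `Σ_{q ∈ Q, q ≡ a (mod n)} F(q)` (`Q` = the good primes of the block, `F` = the dual weight
`Φ̂·…` at fixed `(h₁, s, …)`). GATE G2 §(a) a8 splits each into its principal part (a8P: the class-independent density
`1/φ(n)` times the sum over all levels coprime to `n` — then the `s`-sums complete, `OffDiagDualCompletion*`) and the
deviation (a8R: dispersion / ABL Prop. 4.1 for `n` beyond `N^{η/2+ε}`; a8S: characters and zeros for small `n`). This file
fixes that split as kernel objects and records its exact algebra:

* `levelAPSum Q F n a = Σ_{q∈Q, (q : ZMod n) = a} F q`, `levelCoprimeSum Q F n = Σ_{q∈Q, IsUnit (q : ZMod n)} F q`,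
  `levelPrincipal Q F n = levelCoprimeSum/φ(n)`, `levelDeviation Q F n a = levelAPSum − levelPrincipal` (definitions, reviewed);
* `levelAPSum_eq_principal_add_deviation` (the split), `sum_units_levelAPSum` (`Σ_{a unit} levelAPSum a = levelCoprimeSum`),
  **`sum_units_levelDeviation_eq_zero`** (the deviations over the unit classes sum to ZERO exactly — the principal part is
  the class average), `norm_levelAPSum_le`, `levelAPSum_of_not_isUnit` bookkeeping.

Pure finite algebra; standard axioms. Helper toward `stub_offDiagBelowSlack_io`; closes nothing (bounding the deviations is
L7/L8 of OMEGA-BLUEPRINT, conditional on ABL Prop. 4.1 / H8a–H8b).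
«The programme SEARCHES and TYPES; no claim about Landau–Siegel zeros, Theorems 1–2 of arXiv:2211.02515 or
a repaired Margin232 until a kernel theorem says so.»
-/

noncomputable section

namespace Summit.Parity.GeneralizedHardyLittlewood.Theorems.BeyondDiagonalBeatsQuarter.OffDiag

open Finset

/-! ### The objects -/

/-- **Level sum in a residue class**: `Σ_{q ∈ Q, q ≡ a (mod n)} F(q)`. [cite: Drappeau2017, Thm 1.2 (shape of T(x;q,a)) — derivation] -/
def levelAPSum (Q : Finset ℕ) (F : ℕ → ℂ) (n : ℕ) (a : ZMod n) : ℂ :=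
  ∑ q ∈ Q.filter (fun q : ℕ ↦ (q : ZMod n) = a), F q

open Classical in
/-- **Level sum over the classes coprime to the modulus**: `Σ_{q ∈ Q, (q,n) = 1} F(q)`.
[cite: Drappeau2017, Thm 1.2 — derivation] -/
def levelCoprimeSum (Q : Finset ℕ) (F : ℕ → ℂ) (n : ℕ) : ℂ :=
  ∑ q ∈ Q.filter (fun q : ℕ ↦ IsUnit ((q : ℕ) : ZMod n)), F q

/-- **Principal part** of a level sum in a reduced class: the density `1/φ(n)` times the coprime sum (class-independent).
[cite: Drappeau2017, Thm 1.2 — derivation] -/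
def levelPrincipal (Q : Finset ℕ) (F : ℕ → ℂ) (n : ℕ) : ℂ :=
  (Nat.totient n : ℂ)⁻¹ * levelCoprimeSum Q F n

/-- **Deviation** of a level sum from its principal part: `Σ_{q≡a} F − φ(n)⁻¹ Σ_{(q,n)=1} F`.
[cite: Drappeau2017, Thm 1.2 — derivation] -/
def levelDeviation (Q : Finset ℕ) (F : ℕ → ℂ) (n : ℕ) (a : ZMod n) : ℂ :=
  levelAPSum Q F n a - levelPrincipal Q F n

/-! ### The exact algebra of the split -/

variable (Q : Finset ℕ) (F : ℕ → ℂ) (n : ℕ)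

/-- The split: `levelAPSum = levelPrincipal + levelDeviation`. [folklore] -/
theorem levelAPSum_eq_principal_add_deviation (a : ZMod n) :
    levelAPSum Q F n a = levelPrincipal Q F n + levelDeviation Q F n a := by
  rw [levelDeviation]; ring

/-- A class that is not a unit contains only levels NOT coprime to `n`; for a set of primes not dividing `n` it is empty.
Bookkeeping form: if no `q ∈ Q` reduces to `a`, the level sum is `0`. [folklore] -/
theorem levelAPSum_eq_zero_of_forall_ne {a : ZMod n} (h : ∀ q ∈ Q, (q : ZMod n) ≠ a) : levelAPSum Q F n a = 0 := by
  rw [levelAPSum, Finset.filter_false_of_mem (fun q hq ↦ h q hq), Finset.sum_empty]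

/-- Triangle inequality for a level sum. [folklore] -/
theorem norm_levelAPSum_le (a : ZMod n) : ‖levelAPSum Q F n a‖ ≤ ∑ q ∈ Q, ‖F q‖ := by
  rw [levelAPSum]
  exact (norm_sum_le _ _).trans (Finset.sum_le_sum_of_subset_of_nonneg (Finset.filter_subset _ _)
    fun _ _ _ ↦ norm_nonneg _)

/-- For a level `q` that IS a unit mod `n`: exactly one unit class contains it. [folklore] -/
theorem sum_units_ite_eq_of_isUnit [NeZero n] {q : ℕ} (hq : IsUnit ((q : ℕ) : ZMod n)) (x : ℂ) :
    ∑ u : (ZMod n)ˣ, (if (q : ZMod n) = (u : ZMod n) then x else 0) = x := by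
  classical
  obtain ⟨u₀, hu₀⟩ := hq
  rw [Finset.sum_eq_single u₀]
  · rw [if_pos hu₀.symm]
  · intro v _ hv
    rw [if_neg]
    intro h
    exact hv (Units.ext (by rw [← h, hu₀]))
  · intro h; exact absurd (Finset.mem_univ u₀) h

/-- For a level `q` that is NOT a unit mod `n`: no unit class contains it. [folklore] -/
theorem sum_units_ite_eq_of_not_isUnit [NeZero n] {q : ℕ} (hq : ¬ IsUnit ((q : ℕ) : ZMod n)) (x : ℂ) :
    ∑ u : (ZMod n)ˣ, (if (q : ZMod n) = (u : ZMod n) then x else 0) = 0 := by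
  classical
  refine Finset.sum_eq_zero fun u _ ↦ ?_
  rw [if_neg]
  intro h
  exact hq ⟨u, h.symm⟩

open Classical in
/-- **Summing the class sums over the unit classes recovers the coprime sum**:
`Σ_{a ∈ (ℤ/n)ˣ} levelAPSum Q F n a = levelCoprimeSum Q F n`. [folklore] -/
theorem sum_units_levelAPSum [NeZero n] :
    ∑ u : (ZMod n)ˣ, levelAPSum Q F n (u : ZMod n) = levelCoprimeSum Q F n := by
  simp only [levelAPSum, levelCoprimeSum, Finset.sum_filter]
  rw [Finset.sum_comm]
  refine Finset.sum_congr rfl fun q _ ↦ ?_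
  by_cases hq : IsUnit ((q : ℕ) : ZMod n)
  · rw [if_pos hq, sum_units_ite_eq_of_isUnit n hq]
  · rw [if_neg hq, sum_units_ite_eq_of_not_isUnit n hq]

open Classical in
/-- **The deviations over the unit classes sum to zero** (`n ≥ 1`): `Σ_{a ∈ (ℤ/n)ˣ} levelDeviation Q F n a = 0` — the
principal part IS the average of the class sums over the reduced classes. [folklore] -/
theorem sum_units_levelDeviation_eq_zero [NeZero n] :
    ∑ u : (ZMod n)ˣ, levelDeviation Q F n (u : ZMod n) = 0 := by
  simp only [levelDeviation, Finset.sum_sub_distrib, Finset.sum_const, Finset.card_univ, nsmul_eq_mul,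
    levelPrincipal]
  rw [sum_units_levelAPSum, ZMod.card_units_eq_totient]
  have hφ : (Nat.totient n : ℂ) ≠ 0 := by exact_mod_cast (Nat.totient_pos.mpr (NeZero.pos n)).ne'
  rw [← mul_assoc, mul_inv_cancel₀ hφ, one_mul, sub_self]

/-- The principal part does not depend on the class; the split of a unit-class sum in the form consumed downstream:
`Σ_{q≡a} F = φ(n)⁻¹·Σ_{(q,n)=1} F + levelDeviation`. [folklore] -/
theorem levelAPSum_eq (a : ZMod n) :
    levelAPSum Q F n a = (Nat.totient n : ℂ)⁻¹ * levelCoprimeSum Q F n + levelDeviation Q F n a := by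
  rw [levelDeviation, levelPrincipal]; ring

end Summit.Parity.GeneralizedHardyLittlewood.Theorems.BeyondDiagonalBeatsQuarter.OffDiag
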